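import Summits.Ventures.CertifiedManyBodySolver.Observables.StiffnessVirtualStation
import Summits.Ventures.CertifiedManyBodySolver.Observables.StiffnessApexTransportMottStationFan
import Summits.Ventures.CertifiedManyBodySolver.Observables.StiffnessApexTransportMirrorFanWitness
import HarnessLib

/-!
# Ventures/CertifiedManyBodySolver — Observables/StiffnessVirtualStationFan.lean

HONEST FRAMING: one-sided certified CEILINGS on the uniform flux stiffness (t–t′ f-sum class): the «VIRTUAL STATION» of the companion
`Observables/StiffnessVirtualStation.lean` (the target's own energy window read as a floor on the target state's one-body functional at the chord hopping)
bracketed against an apex-transported FAN source (an `n = 1` f-sum row at `t′ < 0` with its `K₂` hinge) instead of a Fermi-sea row; every leaf is CONDITIONAL on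
the rows it names; a ceiling never speaks to the presence of order; not a `T_c` estimate, not a superconductivity verdict; no number of record. Zero compute, no
definition, no claim node, no `sorry`.

Cell `pub/hubbard-fast` (D-0154 (1)(A) «CERTIFICATE REUSE along parameter paths»), seat `hubbard-fast-reuse-2` g9 (`prover-hubbard-fast-reuse-2-g9-0`), line «VIRTUAL STATION»,
object «VS × FAN». Companion of g5's `Observables/StiffnessApexTransportMottStationFan.lean` («MOTT × FAN»): there the right member is the `t′ = 0` Mott STATION BELOW the
target, reached through the apex row of a particle–hole-signed WITNESS (lever `κ_A = U₀|t′|/(U − U₀)`); here the right member is the target's own `U`-chord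
(`hoppingFloor_of_targetUChord`, value `(U₁·hi − U·lo₁)/(U − U₁)` with the LOW source coupling `U₁` and the cap of the next certified coupling, lever
`κ = U₁|t′|/(U − U₁)`), valid for EVERY torus-limit ground state at the target — no witness, no sign lemma; the fan member is unchanged (g3's
`hoppingFloor_of_ownSlot_orbitLower_of_le_diagHop` / `…_of_diagHop_le` on the fan class, transported by the apex row; at `t′ ≥ 0` through g5's mirrored
witness `exists_torusLimit_halfFilling_mirror_hoppingFloor`).

* §1 masters: `ObsStiffnessSeqCeilingAt_of_targetFloor_apexSource_weighted` (target-class floor at any hopping `κ₁` × a universal apex-source floor) and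
  `…_targetFloor_apexSourceWitness_weighted` (× ONE source witness);
* §2 `n = 1`, `t′ ≤ 0`: `…_halfFilling_virtualStation_fanFree_leftLeaf` / `…_fanPriced_leftLeaf` (fan LEFT of `2t′`, chord RIGHT; natural weights);
* §3 `n = 1`, `t′ ≥ 0`: `…_halfFilling_virtualStation_mirrorFanFree_rightLeaf` / `…_mirrorFanPriced_rightLeaf` (chord LEFT, mirrored fan witness RIGHT) — all sides.

NOT said: the chord needs a certified cap at or above the target's coupling (void above the last cap of the density); nothing at `T > 0`; `λ ≠ 0` words are not of this form.

References: T. Koma, H. Tasaki, J. Stat. Phys. 76 (1994) 745, §1 [KomaTasaki1994]; D. J. Scalapino, S. R. White, S.-C. Zhang, PRB 47 (1993) 7995, §II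
[ScalapinoWhiteZhang1993]; E. H. Lieb, F. Y. Wu, Physica A 321 (2003) 1, §1 eq. (3) [LiebWuPhysicaA2003]; R. B. Griffiths, J. Math. Phys. 7 (1966) 1215, §II [Griffiths1966].
-/

noncomputable section

namespace Summit.Ventures.CertifiedManyBodySolver.Observables

open Literature.MathematicalPhysics.QuantumLattice
open Literature.MathematicalPhysics.QuantumLattice.ThermodynamicLimit
open Literature.MathematicalPhysics.QuantumFieldTheory
open Literature.Probability.LatticeModels
open Matrix Finset Filter Topology HubbardWave0
open scoped Matrix BigOperators ComplexOrder

/-! ## §1 Masters: a floor on the TARGET class at one hopping × an apex-transported source floor at another -/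

section Masters

variable {t'P UP n s₂ U₂ κ₁ : ℝ}

/-- **TARGET FLOOR × APEX SOURCE, weighted (any density).** Target `(t′_P, U_P)`, `0 ≤ n < 2`; a floor `ℓ₁ ≤ e_{Φ(1,κ₁,0)}(ω)` for EVERY torus-limit ground state `ω` of the
TARGET class (e.g. the virtual-station chord of the companion file) at some hopping `κ₁`; a source class `(s₂, U₂)`, `0 ≤ U₂ < U_P`, with a floor `ℓ₂` at its apex hopping
`κ₂ = (U_P s₂ − U₂ t′_P)/(U_P − U₂)` for every torus-limit ground state of the source class (apex row ⇒ the same floor on the target state); weights `μ₁, μ₂ ≥ 0`,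
`μ₁ + μ₂ = 1`, `μ₁κ₁ + μ₂κ₂ = 2t′_P`. Then `ObsStiffnessSeqCeilingAt t′_P U_P n c` for every rational `c ≥ −(μ₁ℓ₁ + μ₂ℓ₂)/4`.
[cite: KomaTasaki1994, §1] [cite: ScalapinoWhiteZhang1993, §II] -/
theorem ObsStiffnessSeqCeilingAt_of_targetFloor_apexSource_weighted (hU₂0 : 0 ≤ U₂) (hU₂ : U₂ < UP)
    (hn0 : 0 ≤ n) (hn2 : n < 2) {μ₁ μ₂ : ℝ} (hμ₁ : 0 ≤ μ₁) (hμ₂ : 0 ≤ μ₂) (hμ : μ₁ + μ₂ = 1)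
    (hκ : μ₁ * κ₁ + μ₂ * ((UP * s₂ - U₂ * t'P) / (UP - U₂)) = 2 * t'P) {ℓ₁ ℓ₂ : ℝ}
    (h₁ : ∀ (ω : InfVolFermionState 2) (Ls : ℕ → ℕ) (ψ : ∀ L, Fock (Orb (FermionTorus 2 L))),
      Tendsto Ls atTop atTop →
      (∀ j, IsGroundStateInSector (hubbardTorusTT' (Ls j) 1 t'P UP) (rectN n (Ls j)) 0 (ψ (Ls j))) →
      (∀ j, star (ψ (Ls j)) ⬝ᵥ ψ (Ls j) = 1) → ω.IsTorusLimitOf ψ Ls →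
      ℓ₁ ≤ ω.meanEnergy (hubbardTTPrimeFermionInteraction 1 κ₁ 0) 1)
    (h₂ : ∀ (ω : InfVolFermionState 2) (Ls : ℕ → ℕ) (ψ : ∀ L, Fock (Orb (FermionTorus 2 L))),
      Tendsto Ls atTop atTop →
      (∀ j, IsGroundStateInSector (hubbardTorusTT' (Ls j) 1 s₂ U₂) (rectN n (Ls j)) 0 (ψ (Ls j))) →
      (∀ j, star (ψ (Ls j)) ⬝ᵥ ψ (Ls j) = 1) → ω.IsTorusLimitOf ψ Ls →
      ℓ₂ ≤ ω.meanEnergy (hubbardTTPrimeFermionInteraction 1 ((UP * s₂ - U₂ * t'P) / (UP - U₂)) 0) 1)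
    (c : ℚ) (hc : -(μ₁ * ℓ₁ + μ₂ * ℓ₂) / 4 ≤ ((c : ℚ) : ℝ)) :
    ObsStiffnessSeqCeilingAt t'P UP n c := by
  intro ρs θ₀ _ hθ₀ Ls hLs hst
  refine fluxStiffness_le_of_torusLimitTT'_oddMoment_orbit_certificate_seq t'P (U := UP) (δ := 1 - n) (q := ((c : ℚ) : ℝ)) 0
    Finset.univ Finset.univ_nonempty (by linarith) (by linarith) hθ₀ hLs hst ?_
  intro ω Ms ψ hMs hψ h1 hω
  have hψ' : ∀ j, IsGroundStateInSector (hubbardTorusTT' (Ms j) 1 t'P UP) (rectN n (Ms j)) 0 (ψ (Ms j)) := fun j => by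
    simpa only [sub_sub_cancel] using hψ j
  rw [orbitMean_rotOddMomentLimitFunctionalTT_lam_zero_eq_meanEnergy_twice_tPrime hω.isTranslationInvariant]
  -- member 1: read directly on the target state
  have hl₁ := h₁ ω Ms ψ hMs hψ' h1 hω
  -- member 2: a source inhabitant, its floor, and the apex row to the target state
  obtain ⟨φ₂, g₂, ω₂, hg₂, hφ₂, hφ₂1, hω₂, -, -, -⟩ :=
    exists_isTorusLimitOf_sectorGroundState_TT' 1 s₂ U₂ hn0 hn2.le (Ls := id) tendsto_id
  have hL₂ : Tendsto (id ∘ g₂ : ℕ → ℕ) atTop atTop := tendsto_id.comp hg₂.tendsto_atTop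
  have hapx₂ := InfVolFermionState.IsTorusLimitOf.meanEnergy_apexHopping_le_of_groundStates 1 s₂ t'P hU₂0 hU₂ hn0 hn2
    hω₂ hL₂ (fun j => hφ₂ _) (fun j => hφ₂1 _) hω hMs hψ' h1
  have hl₂ := h₂ ω₂ (id ∘ g₂) φ₂ hL₂ (fun j => hφ₂ _) (fun j => hφ₂1 _) hω₂
  set κ₂ : ℝ := (UP * s₂ - U₂ * t'P) / (UP - U₂) with hκ₂
  have e₁ := ω.meanEnergy_hubbardTTPrime_eq_coords 1 κ₁ 0
  have e₂ := ω.meanEnergy_hubbardTTPrime_eq_coords 1 κ₂ 0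
  have eP := ω.meanEnergy_hubbardTTPrime_eq_coords 1 (2 * t'P) 0
  have haff : ω.meanEnergy (hubbardTTPrimeFermionInteraction 1 (2 * t'P) 0) 1 =
      μ₁ * ω.meanEnergy (hubbardTTPrimeFermionInteraction 1 κ₁ 0) 1 +
        μ₂ * ω.meanEnergy (hubbardTTPrimeFermionInteraction 1 κ₂ 0) 1 := by
    rw [e₁, e₂, eP, ← hκ]
    linear_combination (ω.meanEnergy (hubbardTTPrimeFermionInteraction 1 0 0) 1) * hμ.symm
  have hw₁ := mul_le_mul_of_nonneg_left hl₁ hμ₁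
  have hw₂ := mul_le_mul_of_nonneg_left (hl₂.trans hapx₂) hμ₂
  have hc' : -(μ₁ * ℓ₁ + μ₂ * ℓ₂) / 4 ≤ ((c : ℚ) : ℝ) := hc
  rw [haff]
  linarith

/-- **TARGET FLOOR × APEX SOURCE WITNESS, weighted (any density).** As above, the source floor carried by ONE torus-limit ground state of the source class
(the apex row needs a single source state). [cite: KomaTasaki1994, §1] [cite: ScalapinoWhiteZhang1993, §II] -/
theorem ObsStiffnessSeqCeilingAt_of_targetFloor_apexSourceWitness_weighted (hU₂0 : 0 ≤ U₂) (hU₂ : U₂ < UP)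
    (hn0 : 0 ≤ n) (hn2 : n < 2) {μ₁ μ₂ : ℝ} (hμ₁ : 0 ≤ μ₁) (hμ₂ : 0 ≤ μ₂) (hμ : μ₁ + μ₂ = 1)
    (hκ : μ₁ * κ₁ + μ₂ * ((UP * s₂ - U₂ * t'P) / (UP - U₂)) = 2 * t'P) {ℓ₁ ℓ₂ : ℝ}
    (h₁ : ∀ (ω : InfVolFermionState 2) (Ls : ℕ → ℕ) (ψ : ∀ L, Fock (Orb (FermionTorus 2 L))),
      Tendsto Ls atTop atTop →
      (∀ j, IsGroundStateInSector (hubbardTorusTT' (Ls j) 1 t'P UP) (rectN n (Ls j)) 0 (ψ (Ls j))) →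
      (∀ j, star (ψ (Ls j)) ⬝ᵥ ψ (Ls j) = 1) → ω.IsTorusLimitOf ψ Ls →
      ℓ₁ ≤ ω.meanEnergy (hubbardTTPrimeFermionInteraction 1 κ₁ 0) 1)
    (h₂ : ∃ (ω : InfVolFermionState 2) (Ls : ℕ → ℕ) (ψ : ∀ L, Fock (Orb (FermionTorus 2 L))),
      Tendsto Ls atTop atTop ∧
      (∀ j, IsGroundStateInSector (hubbardTorusTT' (Ls j) 1 s₂ U₂) (rectN n (Ls j)) 0 (ψ (Ls j))) ∧
      (∀ j, star (ψ (Ls j)) ⬝ᵥ ψ (Ls j) = 1) ∧ ω.IsTorusLimitOf ψ Ls ∧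
      ℓ₂ ≤ ω.meanEnergy (hubbardTTPrimeFermionInteraction 1 ((UP * s₂ - U₂ * t'P) / (UP - U₂)) 0) 1)
    (c : ℚ) (hc : -(μ₁ * ℓ₁ + μ₂ * ℓ₂) / 4 ≤ ((c : ℚ) : ℝ)) :
    ObsStiffnessSeqCeilingAt t'P UP n c := by
  intro ρs θ₀ _ hθ₀ Ls hLs hst
  refine fluxStiffness_le_of_torusLimitTT'_oddMoment_orbit_certificate_seq t'P (U := UP) (δ := 1 - n) (q := ((c : ℚ) : ℝ)) 0
    Finset.univ Finset.univ_nonempty (by linarith) (by linarith) hθ₀ hLs hst ?_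
  intro ω Ms ψ hMs hψ h1 hω
  have hψ' : ∀ j, IsGroundStateInSector (hubbardTorusTT' (Ms j) 1 t'P UP) (rectN n (Ms j)) 0 (ψ (Ms j)) := fun j => by
    simpa only [sub_sub_cancel] using hψ j
  rw [orbitMean_rotOddMomentLimitFunctionalTT_lam_zero_eq_meanEnergy_twice_tPrime hω.isTranslationInvariant]
  have hl₁ := h₁ ω Ms ψ hMs hψ' h1 hω
  obtain ⟨ω₂, L₂, φ₂, hL₂, hφ₂, hφ₂1, hω₂, hl₂⟩ := h₂
  have hapx₂ := InfVolFermionState.IsTorusLimitOf.meanEnergy_apexHopping_le_of_groundStates 1 s₂ t'P hU₂0 hU₂ hn0 hn2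
    hω₂ hL₂ hφ₂ hφ₂1 hω hMs hψ' h1
  set κ₂ : ℝ := (UP * s₂ - U₂ * t'P) / (UP - U₂) with hκ₂
  have e₁ := ω.meanEnergy_hubbardTTPrime_eq_coords 1 κ₁ 0
  have e₂ := ω.meanEnergy_hubbardTTPrime_eq_coords 1 κ₂ 0
  have eP := ω.meanEnergy_hubbardTTPrime_eq_coords 1 (2 * t'P) 0
  have haff : ω.meanEnergy (hubbardTTPrimeFermionInteraction 1 (2 * t'P) 0) 1 =
      μ₁ * ω.meanEnergy (hubbardTTPrimeFermionInteraction 1 κ₁ 0) 1 +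
        μ₂ * ω.meanEnergy (hubbardTTPrimeFermionInteraction 1 κ₂ 0) 1 := by
    rw [e₁, e₂, eP, ← hκ]
    linear_combination (ω.meanEnergy (hubbardTTPrimeFermionInteraction 1 0 0) 1) * hμ.symm
  have hw₁ := mul_le_mul_of_nonneg_left hl₁ hμ₁
  have hw₂ := mul_le_mul_of_nonneg_left (hl₂.trans hapx₂) hμ₂
  have hc' : -(μ₁ * ℓ₁ + μ₂ * ℓ₂) / 4 ≤ ((c : ℚ) : ℝ) := hc
  rw [haff]
  linarith

end Masters

/-! ## §2 `n = 1`, `t′ ≤ 0`: virtual station (chord) on the RIGHT × fan source on the LEFT -/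

section LeftLeaves

variable {U₁ lo₁ hi s₂ U₂ UP t'P : ℝ}

/-- **VS × FAN, `t′ ≤ 0`, FREE fan orientation** (`n = 1`). Chord: floor `lo₁ ≤ e(1, 0, U₁, 1)` at `0 ≤ U₁ < U_P`, cap `e(1, t′, U_P, 1) ≤ hi`, hopping
`κ_A = (U_P·0 − U₁t′)/(U_P − U₁) ≥ 2t′`, value `−(U_P·lo₁ − U₁·hi)/(U_P − U₁)`; fan class `(s₂, U₂, 1)` (`s₂ < 0`, `0 ≤ U₂ < U_P`) with its own f-sum orbit-lower family
`v₂` at the slot `s₂`, apex hopping `κ_B = (U_P s₂ − U₂t′)/(U_P − U₂)` with `2s₂ ≤ κ_B < 2t′` (free orientation, `K₂ ≥ 0` on the fan class); natural weights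
`μ_A = (2t′ − κ_B)/(κ_A − κ_B)`, `μ_B = (κ_A − 2t′)/(κ_A − κ_B)`: `c ≥ μ_A·X/4 + μ_B·(−v₂)` with `X = (U₁·hi − U_P·lo₁)/(U_P − U₁)` gives `ObsStiffnessSeqCeilingAt t′ U_P 1 c`.
[cite: KomaTasaki1994, §1] [cite: ScalapinoWhiteZhang1993, §II] [cite: LiebWuPhysicaA2003, §1 eq. (3)] -/
theorem ObsStiffnessSeqCeilingAt_halfFilling_virtualStation_fanFree_leftLeaf (Uo₂ : ℝ) (hU₁0 : 0 ≤ U₁) (hUA : U₁ < UP)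
    (hfloor : lo₁ ≤ energyDensityTT' 1 0 U₁ 1) (hcap : energyDensityTT' 1 t'P UP 1 ≤ hi)
    (hs₂ : s₂ < 0) (hU₂0 : 0 ≤ U₂) {v₂ : ℝ}
    (h₂ : ∀ (ω : InfVolFermionState 2) (Ls : ℕ → ℕ) (ψ : ∀ L, Fock (Orb (FermionTorus 2 L))),
      Tendsto Ls atTop atTop →
      (∀ j, IsGroundStateInSector (hubbardTorusTT' (Ls j) 1 s₂ U₂) (rectN 1 (Ls j)) 0 (ψ (Ls j))) →
      (∀ j, star (ψ (Ls j)) ⬝ᵥ ψ (Ls j) = 1) → ω.IsTorusLimitOf ψ Ls →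
      v₂ ≤ ((Finset.univ : Finset (DihedralGroup 4)).card : ℝ)⁻¹ * ∑ g ∈ (Finset.univ : Finset (DihedralGroup 4)),
        (ω.expect (d4ShiftSet g 0 (box 2 7)) (fermionEmbed (PolySite.d4Emb g 0 (box 2 7)) (-oddMomentObsTT s₂ Uo₂ 0))).re)
    (hUB : U₂ < UP) (ht : t'P ≤ 0)
    (hfree : 2 * s₂ ≤ (UP * s₂ - U₂ * t'P) / (UP - U₂)) (hleft : (UP * s₂ - U₂ * t'P) / (UP - U₂) < 2 * t'P) (c : ℚ)
    (hc : (2 * t'P - (UP * s₂ - U₂ * t'P) / (UP - U₂)) / ((UP * 0 - U₁ * t'P) / (UP - U₁) - (UP * s₂ - U₂ * t'P) / (UP - U₂)) *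
        (((U₁ * hi - UP * lo₁) / (UP - U₁)) / 4) +
      ((UP * 0 - U₁ * t'P) / (UP - U₁) - 2 * t'P) / ((UP * 0 - U₁ * t'P) / (UP - U₁) - (UP * s₂ - U₂ * t'P) / (UP - U₂)) * (-v₂) ≤ ((c : ℚ) : ℝ)) :
    ObsStiffnessSeqCeilingAt t'P UP 1 c := by
  have hd : 0 < UP - U₁ := by linarith
  have hR : 2 * t'P ≤ (UP * 0 - U₁ * t'P) / (UP - U₁) := by
    rw [le_div_iff₀ hd]; nlinarith [mul_nonneg_of_nonpos_of_nonpos ht (by linarith : -(2 * UP - U₁) ≤ 0)]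
  have hlt : (UP * s₂ - U₂ * t'P) / (UP - U₂) < (UP * 0 - U₁ * t'P) / (UP - U₁) := lt_of_lt_of_le hleft hR
  obtain ⟨hμ₁, hμ₂, hsum, hcomb⟩ := anchor_weights_left hlt hleft.le hR
  refine ObsStiffnessSeqCeilingAt_of_targetFloor_apexSource_weighted (κ₁ := (UP * 0 - U₁ * t'P) / (UP - U₁)) (n := 1) hU₂0 hUB zero_le_one one_lt_two
    hμ₁ hμ₂ hsum hcomb
    (hoppingFloor_of_targetUChord (t₁ := 0) hU₁0 hUA zero_le_one one_lt_two hfloor hcap)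
    (hoppingFloor_of_ownSlot_orbitLower_of_le_diagHop Uo₂ v₂ hfree h₂
      (forall_torusLimit_halfFilling_diagHop_nonneg_of_tPrime_neg hs₂ hU₂0)) c ?_
  have e : -((2 * t'P - (UP * s₂ - U₂ * t'P) / (UP - U₂)) / ((UP * 0 - U₁ * t'P) / (UP - U₁) - (UP * s₂ - U₂ * t'P) / (UP - U₂)) *
        ((UP * lo₁ - U₁ * hi) / (UP - U₁)) +
      ((UP * 0 - U₁ * t'P) / (UP - U₁) - 2 * t'P) / ((UP * 0 - U₁ * t'P) / (UP - U₁) - (UP * s₂ - U₂ * t'P) / (UP - U₂)) *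
        (4 * v₂ + ((UP * s₂ - U₂ * t'P) / (UP - U₂) - 2 * s₂) * 0)) / 4 =
      (2 * t'P - (UP * s₂ - U₂ * t'P) / (UP - U₂)) / ((UP * 0 - U₁ * t'P) / (UP - U₁) - (UP * s₂ - U₂ * t'P) / (UP - U₂)) *
        (((U₁ * hi - UP * lo₁) / (UP - U₁)) / 4) +
      ((UP * 0 - U₁ * t'P) / (UP - U₁) - 2 * t'P) / ((UP * 0 - U₁ * t'P) / (UP - U₁) - (UP * s₂ - U₂ * t'P) / (UP - U₂)) * (-v₂) := by ring
  rw [e]; exact hc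

/-- **VS × FAN, `t′ ≤ 0`, PRICED fan orientation** (`κ_B ≤ 2s₂`, ceiling `K₂ ≤ A₂` on the fan class: fan floor `4v₂ + (κ_B − 2s₂)A₂` at `κ_B`):
`c ≥ μ_A·X/4 + μ_B·(−v₂ + (2s₂ − κ_B)A₂/4)`. [cite: KomaTasaki1994, §1] [cite: ScalapinoWhiteZhang1993, §II] [cite: LiebWuPhysicaA2003, §1 eq. (3)] -/
theorem ObsStiffnessSeqCeilingAt_halfFilling_virtualStation_fanPriced_leftLeaf (Uo₂ : ℝ) (hU₁0 : 0 ≤ U₁) (hUA : U₁ < UP)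
    (hfloor : lo₁ ≤ energyDensityTT' 1 0 U₁ 1) (hcap : energyDensityTT' 1 t'P UP 1 ≤ hi)
    (hU₂0 : 0 ≤ U₂) {v₂ : ℝ}
    (h₂ : ∀ (ω : InfVolFermionState 2) (Ls : ℕ → ℕ) (ψ : ∀ L, Fock (Orb (FermionTorus 2 L))),
      Tendsto Ls atTop atTop →
      (∀ j, IsGroundStateInSector (hubbardTorusTT' (Ls j) 1 s₂ U₂) (rectN 1 (Ls j)) 0 (ψ (Ls j))) →
      (∀ j, star (ψ (Ls j)) ⬝ᵥ ψ (Ls j) = 1) → ω.IsTorusLimitOf ψ Ls →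
      v₂ ≤ ((Finset.univ : Finset (DihedralGroup 4)).card : ℝ)⁻¹ * ∑ g ∈ (Finset.univ : Finset (DihedralGroup 4)),
        (ω.expect (d4ShiftSet g 0 (box 2 7)) (fermionEmbed (PolySite.d4Emb g 0 (box 2 7)) (-oddMomentObsTT s₂ Uo₂ 0))).re)
    {A₂ : ℝ}
    (hA₂ : ∀ (ω : InfVolFermionState 2) (Ls : ℕ → ℕ) (ψ : ∀ L, Fock (Orb (FermionTorus 2 L))),
      Tendsto Ls atTop atTop →
      (∀ j, IsGroundStateInSector (hubbardTorusTT' (Ls j) 1 s₂ U₂) (rectN 1 (Ls j)) 0 (ψ (Ls j))) →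
      (∀ j, star (ψ (Ls j)) ⬝ᵥ ψ (Ls j) = 1) → ω.IsTorusLimitOf ψ Ls →
      ω.meanEnergy (hubbardTTPrimeFermionInteraction 0 1 0) 1 ≤ A₂)
    (hUB : U₂ < UP) (ht : t'P ≤ 0)
    (hpriced : (UP * s₂ - U₂ * t'P) / (UP - U₂) ≤ 2 * s₂) (hleft : (UP * s₂ - U₂ * t'P) / (UP - U₂) < 2 * t'P) (c : ℚ)
    (hc : (2 * t'P - (UP * s₂ - U₂ * t'P) / (UP - U₂)) / ((UP * 0 - U₁ * t'P) / (UP - U₁) - (UP * s₂ - U₂ * t'P) / (UP - U₂)) *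
        (((U₁ * hi - UP * lo₁) / (UP - U₁)) / 4) +
      ((UP * 0 - U₁ * t'P) / (UP - U₁) - 2 * t'P) / ((UP * 0 - U₁ * t'P) / (UP - U₁) - (UP * s₂ - U₂ * t'P) / (UP - U₂)) *
        (-v₂ + (2 * s₂ - (UP * s₂ - U₂ * t'P) / (UP - U₂)) * A₂ / 4) ≤ ((c : ℚ) : ℝ)) :
    ObsStiffnessSeqCeilingAt t'P UP 1 c := by
  have hd : 0 < UP - U₁ := by linarith
  have hR : 2 * t'P ≤ (UP * 0 - U₁ * t'P) / (UP - U₁) := by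
    rw [le_div_iff₀ hd]; nlinarith [mul_nonneg_of_nonpos_of_nonpos ht (by linarith : -(2 * UP - U₁) ≤ 0)]
  have hlt : (UP * s₂ - U₂ * t'P) / (UP - U₂) < (UP * 0 - U₁ * t'P) / (UP - U₁) := lt_of_lt_of_le hleft hR
  obtain ⟨hμ₁, hμ₂, hsum, hcomb⟩ := anchor_weights_left hlt hleft.le hR
  refine ObsStiffnessSeqCeilingAt_of_targetFloor_apexSource_weighted (κ₁ := (UP * 0 - U₁ * t'P) / (UP - U₁)) (n := 1) hU₂0 hUB zero_le_one one_lt_two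
    hμ₁ hμ₂ hsum hcomb
    (hoppingFloor_of_targetUChord (t₁ := 0) hU₁0 hUA zero_le_one one_lt_two hfloor hcap)
    (hoppingFloor_of_ownSlot_orbitLower_of_diagHop_le Uo₂ v₂ hpriced h₂ hA₂) c ?_
  have e : -((2 * t'P - (UP * s₂ - U₂ * t'P) / (UP - U₂)) / ((UP * 0 - U₁ * t'P) / (UP - U₁) - (UP * s₂ - U₂ * t'P) / (UP - U₂)) *
        ((UP * lo₁ - U₁ * hi) / (UP - U₁)) +
      ((UP * 0 - U₁ * t'P) / (UP - U₁) - 2 * t'P) / ((UP * 0 - U₁ * t'P) / (UP - U₁) - (UP * s₂ - U₂ * t'P) / (UP - U₂)) *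
        (4 * v₂ + ((UP * s₂ - U₂ * t'P) / (UP - U₂) - 2 * s₂) * A₂)) / 4 =
      (2 * t'P - (UP * s₂ - U₂ * t'P) / (UP - U₂)) / ((UP * 0 - U₁ * t'P) / (UP - U₁) - (UP * s₂ - U₂ * t'P) / (UP - U₂)) *
        (((U₁ * hi - UP * lo₁) / (UP - U₁)) / 4) +
      ((UP * 0 - U₁ * t'P) / (UP - U₁) - 2 * t'P) / ((UP * 0 - U₁ * t'P) / (UP - U₁) - (UP * s₂ - U₂ * t'P) / (UP - U₂)) *
        (-v₂ + (2 * s₂ - (UP * s₂ - U₂ * t'P) / (UP - U₂)) * A₂ / 4) := by ring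
  rw [e]; exact hc

end LeftLeaves

/-! ## §3 `n = 1`, `t′ ≥ 0`: virtual station (chord) on the LEFT × the MIRRORED fan witness on the RIGHT — every sequence of sides -/

section RightLeaves

variable {U₁ lo₁ hi s₂ U₂ UP t'P : ℝ}

/-- **VS × MIRRORED FAN, `t′ ≥ 0`, FREE orientation** (`n = 1`). Chord at `κ_A = (U_P·0 − U₁t′)/(U_P − U₁) ≤ 2t′` (every target state); fan class `(s₂, U₂, 1)`, `s₂ < 0`, own
family `v₂`; the MIRROR class `(−s₂, U₂, 1)` has apex hopping `κ_B⁺ = (U_P(−s₂) − U₂t′)/(U_P − U₂)` with `2t′ < κ_B⁺` and carries, by ONE mirrored witness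
(`exists_torusLimit_halfFilling_mirror_hoppingFloor`), the fan floor read at `−κ_B⁺` (free orientation `2s₂ ≤ −κ_B⁺`): `c ≥ μ_A·X/4 + μ_B·(−v₂)`, `μ_A = (κ_B⁺ − 2t′)/(κ_B⁺ − κ_A)`.
[cite: KomaTasaki1994, §1] [cite: LiebWuPhysicaA2003, §1 eq. (3)] -/
theorem ObsStiffnessSeqCeilingAt_halfFilling_virtualStation_mirrorFanFree_rightLeaf (Uo₂ : ℝ) (hU₁0 : 0 ≤ U₁) (hUA : U₁ < UP)
    (hfloor : lo₁ ≤ energyDensityTT' 1 0 U₁ 1) (hcap : energyDensityTT' 1 t'P UP 1 ≤ hi)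
    (hs₂ : s₂ < 0) (hU₂0 : 0 ≤ U₂) {v₂ : ℝ}
    (h₂ : ∀ (ω : InfVolFermionState 2) (Ls : ℕ → ℕ) (ψ : ∀ L, Fock (Orb (FermionTorus 2 L))),
      Tendsto Ls atTop atTop →
      (∀ j, IsGroundStateInSector (hubbardTorusTT' (Ls j) 1 s₂ U₂) (rectN 1 (Ls j)) 0 (ψ (Ls j))) →
      (∀ j, star (ψ (Ls j)) ⬝ᵥ ψ (Ls j) = 1) → ω.IsTorusLimitOf ψ Ls →
      v₂ ≤ ((Finset.univ : Finset (DihedralGroup 4)).card : ℝ)⁻¹ * ∑ g ∈ (Finset.univ : Finset (DihedralGroup 4)),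
        (ω.expect (d4ShiftSet g 0 (box 2 7)) (fermionEmbed (PolySite.d4Emb g 0 (box 2 7)) (-oddMomentObsTT s₂ Uo₂ 0))).re)
    (hUB : U₂ < UP) (ht : 0 ≤ t'P)
    (hfree : 2 * s₂ ≤ -((UP * (-s₂) - U₂ * t'P) / (UP - U₂))) (hright : 2 * t'P < (UP * (-s₂) - U₂ * t'P) / (UP - U₂)) (c : ℚ)
    (hc : ((UP * (-s₂) - U₂ * t'P) / (UP - U₂) - 2 * t'P) / ((UP * (-s₂) - U₂ * t'P) / (UP - U₂) - (UP * 0 - U₁ * t'P) / (UP - U₁)) *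
        (((U₁ * hi - UP * lo₁) / (UP - U₁)) / 4) +
      (2 * t'P - (UP * 0 - U₁ * t'P) / (UP - U₁)) / ((UP * (-s₂) - U₂ * t'P) / (UP - U₂) - (UP * 0 - U₁ * t'P) / (UP - U₁)) * (-v₂) ≤ ((c : ℚ) : ℝ)) :
    ObsStiffnessSeqCeilingAt t'P UP 1 c := by
  have hd : 0 < UP - U₁ := by linarith
  have hL : (UP * 0 - U₁ * t'P) / (UP - U₁) ≤ 2 * t'P := by
    rw [div_le_iff₀ hd]; nlinarith [mul_nonneg ht (by linarith : 0 ≤ 2 * UP - U₁)]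
  have hlt : (UP * 0 - U₁ * t'P) / (UP - U₁) < (UP * (-s₂) - U₂ * t'P) / (UP - U₂) := lt_of_le_of_lt hL hright
  obtain ⟨hμ₁, hμ₂, hsum, hcomb⟩ := bracket_weights hlt hL hright.le
  have hfl := hoppingFloor_of_ownSlot_orbitLower_of_le_diagHop Uo₂ v₂ hfree h₂
    (forall_torusLimit_halfFilling_diagHop_nonneg_of_tPrime_neg hs₂ hU₂0)
  have hwit := exists_torusLimit_halfFilling_mirror_hoppingFloor (-((UP * (-s₂) - U₂ * t'P) / (UP - U₂))) hfl
  simp only [neg_neg] at hwit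
  refine ObsStiffnessSeqCeilingAt_of_targetFloor_apexSourceWitness_weighted (κ₁ := (UP * 0 - U₁ * t'P) / (UP - U₁)) (s₂ := -s₂) (n := 1)
    hU₂0 hUB zero_le_one one_lt_two hμ₁ hμ₂ hsum hcomb
    (hoppingFloor_of_targetUChord (t₁ := 0) hU₁0 hUA zero_le_one one_lt_two hfloor hcap) hwit c ?_
  have e : -(((UP * (-s₂) - U₂ * t'P) / (UP - U₂) - 2 * t'P) / ((UP * (-s₂) - U₂ * t'P) / (UP - U₂) - (UP * 0 - U₁ * t'P) / (UP - U₁)) *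
        ((UP * lo₁ - U₁ * hi) / (UP - U₁)) +
      (2 * t'P - (UP * 0 - U₁ * t'P) / (UP - U₁)) / ((UP * (-s₂) - U₂ * t'P) / (UP - U₂) - (UP * 0 - U₁ * t'P) / (UP - U₁)) *
        (4 * v₂ + (-((UP * (-s₂) - U₂ * t'P) / (UP - U₂)) - 2 * s₂) * 0)) / 4 =
      ((UP * (-s₂) - U₂ * t'P) / (UP - U₂) - 2 * t'P) / ((UP * (-s₂) - U₂ * t'P) / (UP - U₂) - (UP * 0 - U₁ * t'P) / (UP - U₁)) *
        (((U₁ * hi - UP * lo₁) / (UP - U₁)) / 4) +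
      (2 * t'P - (UP * 0 - U₁ * t'P) / (UP - U₁)) / ((UP * (-s₂) - U₂ * t'P) / (UP - U₂) - (UP * 0 - U₁ * t'P) / (UP - U₁)) * (-v₂) := by ring
  rw [e]; exact hc

/-- **VS × MIRRORED FAN, `t′ ≥ 0`, PRICED orientation** (`−κ_B⁺ ≤ 2s₂`, ceiling `K₂ ≤ A₂` on the fan class): `c ≥ μ_A·X/4 + μ_B·(−v₂ + (2s₂ + κ_B⁺)A₂/4)`.
[cite: KomaTasaki1994, §1] [cite: LiebWuPhysicaA2003, §1 eq. (3)] -/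
theorem ObsStiffnessSeqCeilingAt_halfFilling_virtualStation_mirrorFanPriced_rightLeaf (Uo₂ : ℝ) (hU₁0 : 0 ≤ U₁) (hUA : U₁ < UP)
    (hfloor : lo₁ ≤ energyDensityTT' 1 0 U₁ 1) (hcap : energyDensityTT' 1 t'P UP 1 ≤ hi)
    (hU₂0 : 0 ≤ U₂) {v₂ : ℝ}
    (h₂ : ∀ (ω : InfVolFermionState 2) (Ls : ℕ → ℕ) (ψ : ∀ L, Fock (Orb (FermionTorus 2 L))),
      Tendsto Ls atTop atTop →
      (∀ j, IsGroundStateInSector (hubbardTorusTT' (Ls j) 1 s₂ U₂) (rectN 1 (Ls j)) 0 (ψ (Ls j))) →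
      (∀ j, star (ψ (Ls j)) ⬝ᵥ ψ (Ls j) = 1) → ω.IsTorusLimitOf ψ Ls →
      v₂ ≤ ((Finset.univ : Finset (DihedralGroup 4)).card : ℝ)⁻¹ * ∑ g ∈ (Finset.univ : Finset (DihedralGroup 4)),
        (ω.expect (d4ShiftSet g 0 (box 2 7)) (fermionEmbed (PolySite.d4Emb g 0 (box 2 7)) (-oddMomentObsTT s₂ Uo₂ 0))).re)
    {A₂ : ℝ}
    (hA₂ : ∀ (ω : InfVolFermionState 2) (Ls : ℕ → ℕ) (ψ : ∀ L, Fock (Orb (FermionTorus 2 L))),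
      Tendsto Ls atTop atTop →
      (∀ j, IsGroundStateInSector (hubbardTorusTT' (Ls j) 1 s₂ U₂) (rectN 1 (Ls j)) 0 (ψ (Ls j))) →
      (∀ j, star (ψ (Ls j)) ⬝ᵥ ψ (Ls j) = 1) → ω.IsTorusLimitOf ψ Ls →
      ω.meanEnergy (hubbardTTPrimeFermionInteraction 0 1 0) 1 ≤ A₂)
    (hUB : U₂ < UP) (ht : 0 ≤ t'P)
    (hpriced : -((UP * (-s₂) - U₂ * t'P) / (UP - U₂)) ≤ 2 * s₂) (hright : 2 * t'P < (UP * (-s₂) - U₂ * t'P) / (UP - U₂)) (c : ℚ)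
    (hc : ((UP * (-s₂) - U₂ * t'P) / (UP - U₂) - 2 * t'P) / ((UP * (-s₂) - U₂ * t'P) / (UP - U₂) - (UP * 0 - U₁ * t'P) / (UP - U₁)) *
        (((U₁ * hi - UP * lo₁) / (UP - U₁)) / 4) +
      (2 * t'P - (UP * 0 - U₁ * t'P) / (UP - U₁)) / ((UP * (-s₂) - U₂ * t'P) / (UP - U₂) - (UP * 0 - U₁ * t'P) / (UP - U₁)) *
        (-v₂ + (2 * s₂ + (UP * (-s₂) - U₂ * t'P) / (UP - U₂)) * A₂ / 4) ≤ ((c : ℚ) : ℝ)) :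
    ObsStiffnessSeqCeilingAt t'P UP 1 c := by
  have hd : 0 < UP - U₁ := by linarith
  have hL : (UP * 0 - U₁ * t'P) / (UP - U₁) ≤ 2 * t'P := by
    rw [div_le_iff₀ hd]; nlinarith [mul_nonneg ht (by linarith : 0 ≤ 2 * UP - U₁)]
  have hlt : (UP * 0 - U₁ * t'P) / (UP - U₁) < (UP * (-s₂) - U₂ * t'P) / (UP - U₂) := lt_of_le_of_lt hL hright
  obtain ⟨hμ₁, hμ₂, hsum, hcomb⟩ := bracket_weights hlt hL hright.le
  have hfl := hoppingFloor_of_ownSlot_orbitLower_of_diagHop_le Uo₂ v₂ hpriced h₂ hA₂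
  have hwit := exists_torusLimit_halfFilling_mirror_hoppingFloor (-((UP * (-s₂) - U₂ * t'P) / (UP - U₂))) hfl
  simp only [neg_neg] at hwit
  refine ObsStiffnessSeqCeilingAt_of_targetFloor_apexSourceWitness_weighted (κ₁ := (UP * 0 - U₁ * t'P) / (UP - U₁)) (s₂ := -s₂) (n := 1)
    hU₂0 hUB zero_le_one one_lt_two hμ₁ hμ₂ hsum hcomb
    (hoppingFloor_of_targetUChord (t₁ := 0) hU₁0 hUA zero_le_one one_lt_two hfloor hcap) hwit c ?_
  have e : -(((UP * (-s₂) - U₂ * t'P) / (UP - U₂) - 2 * t'P) / ((UP * (-s₂) - U₂ * t'P) / (UP - U₂) - (UP * 0 - U₁ * t'P) / (UP - U₁)) *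
        ((UP * lo₁ - U₁ * hi) / (UP - U₁)) +
      (2 * t'P - (UP * 0 - U₁ * t'P) / (UP - U₁)) / ((UP * (-s₂) - U₂ * t'P) / (UP - U₂) - (UP * 0 - U₁ * t'P) / (UP - U₁)) *
        (4 * v₂ + (-((UP * (-s₂) - U₂ * t'P) / (UP - U₂)) - 2 * s₂) * A₂)) / 4 =
      ((UP * (-s₂) - U₂ * t'P) / (UP - U₂) - 2 * t'P) / ((UP * (-s₂) - U₂ * t'P) / (UP - U₂) - (UP * 0 - U₁ * t'P) / (UP - U₁)) *
        (((U₁ * hi - UP * lo₁) / (UP - U₁)) / 4) +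
      (2 * t'P - (UP * 0 - U₁ * t'P) / (UP - U₁)) / ((UP * (-s₂) - U₂ * t'P) / (UP - U₂) - (UP * 0 - U₁ * t'P) / (UP - U₁)) *
        (-v₂ + (2 * s₂ + (UP * (-s₂) - U₂ * t'P) / (UP - U₂)) * A₂ / 4) := by ring
  rw [e]; exact hc

end RightLeaves

end Summit.Ventures.CertifiedManyBodySolver.Observables

end
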